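import Summits.CriticalPhenomena.CardyFormulaZ2.Theorems.CardySelfRefinementLagHandOffTouchCycleDualWinding
import Summits.CriticalPhenomena.CardyFormulaZ2.Theorems.CardySelfRefinementLagHandOffTouchCycleHalfDiag
import Summits.CriticalPhenomena.CardyFormulaZ2.Theorems.CardySelfRefinementLagHandOffTouchOrbitDichotomy
import Summits.CriticalPhenomena.CardyFormulaZ2.Theorems.CardySelfRefinementLagHandOffTouchCycleExterior
import Literature.Probability.RandomPlanarGeometry.PlanarDomains
import Literature.Probability.LatticeModels.InnerFacesHoleFree
import HarnessLib

/-!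
# The touch criterion for the medial exploration of bond-`ℤ²` percolation
(crux `LagHandOff`, stmt-CriticalPhenomena-10268; KERNEL-c7 §4.2): registered stubs
`stub_touch_criterion_arcA` and `stub_touch_criterion_arcB` of line `hitting-tournament`

For admissible discrete Dobrushin data `E` discretising a Jordan (Dobrushin) domain and a bond
configuration `ω`, the chordal medial exploration (`medialExploration E ω`, the cut orbit of the
turning rule `nextCorner (E.bcBondConfig ω)` from the start corner) is the interface between the
open cluster of the wired arc `A` and the dual-open cluster of the dual-wired arc `B` / outside.
The two theorems below are the lattice form of "a cluster reaching the boundary forces the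
interface to visit the contact edge", the trajectory-free touch criterion used by every lateral
argument of the boundary kernel:

* `stub_touch_criterion_arcA`: if an inner face `faceAt x k` at an arc-`A` site `x` is joined to a
  NON-inner face by a dual walk through closed edges of the completed configuration, then the
  corner `(x, k)` is a corner of the chordal exploration (so the exploration visits the
  arc-adjacent edge `cSrc (x, k)` — interface form `exists_mem_medialExploration_of_dualReachable_arcA`);
* `stub_touch_criterion_arcB`: if `faceAt y k` is inner, the target edge of `(y, k)` ends on the
  arc `B`, and `y` is joined to the arc `A` by open edges, then `(y, k)` is a corner of the
  chordal exploration (interface form `exists_mem_medialExploration_of_reachable_arcB`).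

Proof (assembly of the landed wave-2 files of seat c7): by the orbit dichotomy
(`stub_touch_orbit_dichotomy`, …TouchOrbitDichotomy) the corner is on the chordal path or on a
minimal cycle of inner corners; in the cycle case the closed perturbed polygon of the cycle
separates the corner's vertex from its face centre (`stub_touch_wind_vertex_ne_faceCenter`,
…TouchCycleHalfDiag), while both have winding number `0`: the face centre because closed dual
steps do not change the winding (`stub_touch_wind_faceCenter_eq_of_adj/_of_dualReachable`,
…TouchCycleDualWinding) and non-inner face centres have winding `0`
(`stub_touch_wind_faceCenter_eq_zero_of_not_isInnerFace`, …TouchCycleExterior); the vertex because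
a boundary site is a corner of a non-inner face off the cycle
(`stub_touch_wind_vertex_eq_faceCenter_of_not_mem`), after transport along open edges
(`wind_cyLoop_eq_of_reachable`) in the arc-`B` case, where moreover an arc-`B` site is never a
cycle vertex (left-vertex invariant `cornerOrbit_inv_of_base`). Small lattice facts proved here:
the two faces of a target edge are adjacent dual sites with that edge between them
(`faceAt_adj_faceAt_succ`, `dualDartEdge_faceAt_succ`, with the tree's `faceAt_succ_eq`), boundary sites have a non-inner face
(`exists_not_isInnerFace_faceAt_of_mem_zdBoundary`).

References: S. Smirnov, C. R. Acad. Sci. Paris 333 (2001) §2 (the exploration process keeps open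
edges on its left, dual-open on its right); G. Grimmett, *Percolation* (1999) §11.2 (planar
duality); F. Camia, C. M. Newman, Probab. Theory Related Fields 139 (2007) §7 (touching of the
boundary by the exploration path).
-/

noncomputable section

open Set Complex Literature.Topology.PlaneTopology
open Literature.Probability.Percolation Literature.Probability.LatticeModels
open Literature.Probability.RandomPlanarGeometry

namespace Summit.CriticalPhenomena.CardyFormulaZ2.Cruxes.LagHandOff.HittingTournament

/-! ### Small lattice facts -/

/-- The completed configuration only contains edges of the discrete domain, hence lattice edges. -/
theorem bcBondConfig_subset_edgeSet_zdGraph (E : DiscreteDobrushin) (ω : BondConfig (Site 2)) :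
    E.bcBondConfig ω ⊆ (zdGraph 2).edgeSet := by
  intro e he
  have he' := E.bcBondConfig_subset ω he
  induction e using Sym2.ind with
  | h x y =>
    rw [SimpleGraph.mem_edgeSet] at he' ⊢
    exact (meshGraph_adj_iff.1 (discreteDomainGraph_adj_iff.1 he').1).1

/-- A boundary site has a non-inner face around it. -/
theorem exists_not_isInnerFace_faceAt_of_mem_zdBoundary {E : DiscreteDobrushin} {x : Site 2}
    (hx : x ∈ E.zdBoundary) : ∃ k : Fin 4, ¬ E.IsInnerFace (faceAt x k) := by
  rcases hx with hx | ⟨y, hxy⟩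
  · -- a lattice neighbour `y` of `x` is not a domain neighbour: the faces at `x` through `y` are not inner
    obtain ⟨-, y, hxy, hnot⟩ := mem_meshBoundary_iff.1 hx
    obtain ⟨k, rfl⟩ := exists_eq_add_cornerUnit hxy
    refine ⟨k, fun hin => hnot ?_⟩
    exact hin x (x + cornerUnit k) (isCorner_faceAt x k) ((isCorner_add_faceAt_iff x k k).2 (Or.inl rfl)) hxy
  · obtain ⟨-, -, f, hf, hxf, -⟩ := hxy
    obtain ⟨k, rfl⟩ := exists_faceAt_of_isCorner hxf
    exact ⟨k, hf⟩

/-- The left-vertex invariant along the orbit of ANY corner whose vertex lies on the arc `A` or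
on an open edge (generalises `cornerOrbit_inv`, same induction). -/
theorem cornerOrbit_inv_of_base {E : DiscreteDobrushin} {ω : BondConfig (Site 2)} {p : Site 2 × Fin 4}
    (hp : p.1 ∈ E.zdArcA ∨ ∃ e ∈ E.bcBondConfig ω, p.1 ∈ e) (j : ℕ) :
    (cornerOrbit (E.bcBondConfig ω) p j).1 ∈ E.zdArcA ∨
      ∃ e ∈ E.bcBondConfig ω, (cornerOrbit (E.bcBondConfig ω) p j).1 ∈ e := by
  induction j with
  | zero => exact hp
  | succ j ih =>
    change (nextCorner (E.bcBondConfig ω) (cornerOrbit (E.bcBondConfig ω) p j)).1 ∈ E.zdArcA ∨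
      ∃ e ∈ E.bcBondConfig ω, (nextCorner (E.bcBondConfig ω) (cornerOrbit (E.bcBondConfig ω) p j)).1 ∈ e
    by_cases hmem : cTgt (cornerOrbit (E.bcBondConfig ω) p j) ∈ E.bcBondConfig ω
    · rw [nextCorner_of_mem hmem]
      exact Or.inr ⟨_, hmem, Sym2.mem_mk_right _ _⟩
    · rw [nextCorner_of_not_mem hmem]
      exact ih

/-- A site of the arc `B` is never the vertex of a corner on the orbit of an `A`-based corner. -/
theorem cornerOrbit_fst_ne_of_mem_zdArcB {E : DiscreteDobrushin} (hE : E.IsZdAdmissible)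
    {ω : BondConfig (Site 2)} {p : Site 2 × Fin 4}
    (hp : p.1 ∈ E.zdArcA ∨ ∃ e ∈ E.bcBondConfig ω, p.1 ∈ e) {b : Site 2} (hb : b ∈ E.zdArcB) (j : ℕ) :
    (cornerOrbit (E.bcBondConfig ω) p j).1 ≠ b := by
  intro hj
  have hinv := cornerOrbit_inv_of_base (E := E) (ω := ω) hp j
  rw [hj] at hinv
  have hA : b ∈ E.zdArcA := DiscreteDobrushin.mem_zdArcA_of_inv hE hinv (Or.inr hb)
  exact Set.disjoint_left.1 hE.disjoint hA hb

/-- The primal edge crossed by the dual dart `faceAt v k → faceAt v (k + 1)` is the target edge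
of the corner `(v, k)` (four-case coordinate check). -/
theorem dualDartEdge_faceAt_succ (v : Site 2) (k : Fin 4) :
    dualDartEdge (faceAt v k) (faceAt v (k + 1)) = cTgt (v, k) := by
  have n1 : (-Pi.single 0 1 : Site 2) ≠ Pi.single 0 1 := by decide
  have n2 : (-Pi.single 0 1 : Site 2) ≠ Pi.single 1 1 := by decide
  have n5 : (Pi.single 0 1 : Site 2) ≠ Pi.single 1 1 := by decide
  have m1 : (-Pi.single 1 1 + -Pi.single 0 1 : Site 2) ≠ 0 := by decide
  have m2 : (-Pi.single 1 1 + -Pi.single 0 1 : Site 2) ≠ -Pi.single 0 1 + Pi.single 1 1 := by decide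
  have m3 : (-Pi.single 1 1 + Pi.single 0 1 : Site 2) ≠ 0 := by decide
  fin_cases k <;>
    simp [faceAt, cornerOff, cornerUnit, cTgt, dualDartEdge, dualDartLeft, dualDartRight,
      sub_eq_add_neg, add_assoc, n1, n2, n5, m1, m2, m3]

/-- The two faces of the target edge of a corner: `faceAt v k` and `faceAt v (k + 1)` are
adjacent dual sites and the primal edge between them is the target edge. -/
theorem faceAt_adj_faceAt_succ (v : Site 2) (k : Fin 4) :
    (zdGraph 2).Adj (faceAt v k) (faceAt v (k + 1)) ∧
      dualDartEdge (faceAt v k) (faceAt v (k + 1)) = cTgt (v, k) := by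
  refine ⟨?_, dualDartEdge_faceAt_succ v k⟩
  rw [faceAt_succ_eq, ← SimpleGraph.mem_edgeSet]
  exact cSrc_mem_edgeSet (faceAt v k, k + 2)

/-! ### The touch criterion -/

/-- **Touch criterion at the wired arc** (registered stub `stub_touch_criterion_arcA`). -/
theorem stub_touch_criterion_arcA :
    ∀ (Dm : DobrushinDomain) (E : DiscreteDobrushin) (hE : E.IsZdAdmissible), E.Ω = Dm.carrier →
      ∀ (ω : BondConfig (Site 2)) (x : Site 2) (k : Fin 4), x ∈ E.zdArcA → E.IsInnerFace (faceAt x k) →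
      (∃ hf : Site 2, ¬ E.IsInnerFace hf ∧
          (openGraph (dualConfig (E.bcBondConfig ω))).Reachable (faceAt x k) hf) →
      ∃ m ≤ DiscreteDobrushin.exitTime hE ω,
        cornerOrbit (E.bcBondConfig ω) (DiscreteDobrushin.startCorner hE) m = (x, k) := by
  intro Dm E hE hΩ ω x k hxA hin hreach
  obtain ⟨hf, hfnot, hfreach⟩ := hreach
  set β := E.bcBondConfig ω
  have hβzd : β ⊆ (zdGraph 2).edgeSet := bcBondConfig_subset_edgeSet_zdGraph E ω
  have hβdom : β ⊆ (discreteDomainGraph E.Ω E.δ).edgeSet := E.bcBondConfig_subset ω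
  rcases stub_touch_orbit_dichotomy E hE ω (x, k) hin (Or.inl hxA) with hchord | ⟨n, hcyc, hmin, hinner⟩
  · exact hchord
  · exfalso
    -- the cycle separates `x` from the centre of `faceAt x k` …
    have hsep := stub_touch_wind_vertex_ne_faceCenter β (x, k) n hcyc hmin
    -- … but the centre of `faceAt x k` has winding `0` (dual walk to a non-inner face),
    have h1 : wind (fun t => (cyLoop n hcyc).extend t - faceCenter (cFace (x, k))) = 0 := by
      rw [show cFace (x, k) = faceAt x k from rfl, stub_touch_wind_faceCenter_eq_of_dualReachable β hβzd (x, k) n hcyc _ _ hfreach]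
      exact stub_touch_wind_faceCenter_eq_zero_of_not_isInnerFace Dm E hΩ hE.delta_pos β hβdom (x, k) n hcyc hinner hf hfnot
    -- … and so has `x` (a boundary site: it is a corner of a non-inner face).
    obtain ⟨k', hk'⟩ := exists_not_isInnerFace_faceAt_of_mem_zdBoundary (E.zdArcA_subset_zdBoundary hxA)
    have h2 : wind (fun t => (cyLoop n hcyc).extend t - Site.toComplex x) = 0 := by
      rw [stub_touch_wind_vertex_eq_faceCenter_of_not_mem β (x, k) n hcyc x k' (fun j hj hjx => hk' (by rw [← show cFace (x, k') = faceAt x k' from rfl, ← hjx]; exact hinner j hj))]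
      exact stub_touch_wind_faceCenter_eq_zero_of_not_isInnerFace Dm E hΩ hE.delta_pos β hβdom (x, k) n hcyc hinner _ hk'
    exact hsep (h2.trans h1.symm)

/-- **Touch criterion at the dual-wired arc** (registered stub `stub_touch_criterion_arcB`). -/
theorem stub_touch_criterion_arcB :
    ∀ (Dm : DobrushinDomain) (E : DiscreteDobrushin) (hE : E.IsZdAdmissible), E.Ω = Dm.carrier →
      ∀ (ω : BondConfig (Site 2)) (y : Site 2) (k : Fin 4), E.IsInnerFace (faceAt y k) →
      y + cornerUnit (k + 1) ∈ E.zdArcB →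
      (∃ a ∈ E.zdArcA, (openGraph (E.bcBondConfig ω)).Reachable a y) →
      ∃ m ≤ DiscreteDobrushin.exitTime hE ω,
        cornerOrbit (E.bcBondConfig ω) (DiscreteDobrushin.startCorner hE) m = (y, k) := by
  intro Dm E hE hΩ ω y k hin hB hreach
  obtain ⟨a, haA, hay⟩ := hreach
  set β := E.bcBondConfig ω
  have hβzd : β ⊆ (zdGraph 2).edgeSet := bcBondConfig_subset_edgeSet_zdGraph E ω
  have hβdom : β ⊆ (discreteDomainGraph E.Ω E.δ).edgeSet := E.bcBondConfig_subset ω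
  -- the base invariant at `y`: on the arc `A`, or an endpoint of an open edge
  have hp : ((y, k) : Site 2 × Fin 4).1 ∈ E.zdArcA ∨ ∃ e ∈ E.bcBondConfig ω, ((y, k) : Site 2 × Fin 4).1 ∈ e := by
    change y ∈ E.zdArcA ∨ ∃ e ∈ E.bcBondConfig ω, y ∈ e
    rcases hay.symm with ⟨w⟩
    cases w with
    | nil => exact Or.inl haA
    | cons hadj _ =>
      rw [openGraph_adj] at hadj
      exact Or.inr ⟨_, hadj.1, Sym2.mem_mk_left _ _⟩
  rcases stub_touch_orbit_dichotomy E hE ω (y, k) hin hp with hchord | ⟨n, hcyc, hmin, hinner⟩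
  · exact hchord
  · exfalso
    set b := y + cornerUnit (k + 1)
    have hsep := stub_touch_wind_vertex_ne_faceCenter β (y, k) n hcyc hmin
    -- `y` has winding `0`: open walk to `a`, then the half-diagonal into a non-inner face at `a`
    obtain ⟨ka, hka⟩ := exists_not_isInnerFace_faceAt_of_mem_zdBoundary (E.zdArcA_subset_zdBoundary haA)
    have hy : wind (fun t => (cyLoop n hcyc).extend t - Site.toComplex y) = 0 := by
      change wind (fun t => (cyLoop n hcyc).extend t - Site.toComplex ((y, k) : Site 2 × Fin 4).1) = 0
      rw [show ((y, k) : Site 2 × Fin 4).1 = y from rfl,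
        ← wind_cyLoop_eq_of_reachable hβzd hcyc hay,
        stub_touch_wind_vertex_eq_faceCenter_of_not_mem β (y, k) n hcyc a ka (fun j hj hja => hka (by rw [← show cFace (a, ka) = faceAt a ka from rfl, ← hja]; exact hinner j hj))]
      exact stub_touch_wind_faceCenter_eq_zero_of_not_isInnerFace Dm E hΩ hE.delta_pos β hβdom (y, k) n hcyc hinner _ hka
    -- the centre of `faceAt y k` has winding `0`: across the closed target edge to `faceAt y (k+1)`,
    -- then the half-diagonal to `b`, then the half-diagonal into a non-inner face at `b`
    obtain ⟨hadj, hdual⟩ := faceAt_adj_faceAt_succ y k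
    have hclosed : dualDartEdge (faceAt y k) (faceAt y (k + 1)) ∉ β := by
      rw [hdual]
      exact DiscreteDobrushin.not_mem_bcBondConfig_of_mem_zdArcB hE (Sym2.mem_mk_right _ _) hB
    have hcorner : IsCorner b (faceAt y (k + 1)) := (isCorner_add_faceAt_iff y (k + 1) (k + 1)).2 (Or.inl rfl)
    obtain ⟨kb, hkb⟩ := exists_faceAt_of_isCorner hcorner
    obtain ⟨kb', hkb'⟩ := exists_not_isInnerFace_faceAt_of_mem_zdBoundary (E.zdArcB_subset_zdBoundary hB)
    have hbne : ∀ (j : ℕ) (kk : Fin 4), j ≤ n → cornerOrbit β (y, k) j ≠ (b, kk) := fun j kk _ hj =>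
      cornerOrbit_fst_ne_of_mem_zdArcB hE hp hB j (by rw [hj])
    have hc : wind (fun t => (cyLoop n hcyc).extend t - faceCenter (cFace (y, k))) = 0 := by
      rw [show cFace (y, k) = faceAt y k from rfl, stub_touch_wind_faceCenter_eq_of_adj β hβzd (y, k) n hcyc _ _ hadj hclosed, hkb,
        ← stub_touch_wind_vertex_eq_faceCenter_of_not_mem β (y, k) n hcyc b kb (fun j hj => hbne j kb hj),
        stub_touch_wind_vertex_eq_faceCenter_of_not_mem β (y, k) n hcyc b kb' (fun j hj => hbne j kb' hj)]
      exact stub_touch_wind_faceCenter_eq_zero_of_not_isInnerFace Dm E hΩ hE.delta_pos β hβdom (y, k) n hcyc hinner _ hkb'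
    exact hsep (hy.trans hc.symm)

/-! ### Touch form: the exploration visits an arc-adjacent edge -/

/-- A corner of the chordal orbit contributes its source edge to the exploration path. -/
theorem cSrc_mem_medialExploration_of_cornerOrbit_eq {E : DiscreteDobrushin} (hE : E.IsZdAdmissible)
    (ω : BondConfig (Site 2)) {p : Site 2 × Fin 4} {m : ℕ} (hm : m ≤ DiscreteDobrushin.exitTime hE ω)
    (h : cornerOrbit (E.bcBondConfig ω) (DiscreteDobrushin.startCorner hE) m = p) :
    cSrc p ∈ medialExploration E ω := by
  rw [DiscreteDobrushin.medialExploration_eq_explorationList hE ω]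
  have hlt : m < (explorationList (E.bcBondConfig ω) (DiscreteDobrushin.startCorner hE)
      (DiscreteDobrushin.exitTime hE ω)).length := by
    rw [length_explorationList]; omega
  have hget := getElem_explorationList (D := E) (ω := ω) (c₀ := DiscreteDobrushin.startCorner hE) hlt
  rw [h] at hget
  exact hget ▸ List.getElem_mem hlt

/-- **Touch criterion at the wired arc, interface form.** If an inner face at the arc-`A` site
`x` is joined to a non-inner face by a dual walk through closed edges of the completed
configuration, the exploration path visits an edge at `x` (it touches the arc `A` at `x`). -/
theorem exists_mem_medialExploration_of_dualReachable_arcA (Dm : DobrushinDomain) {E : DiscreteDobrushin}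
    (hE : E.IsZdAdmissible) (hΩ : E.Ω = Dm.carrier) (ω : BondConfig (Site 2)) {x : Site 2} {k : Fin 4}
    (hxA : x ∈ E.zdArcA) (hin : E.IsInnerFace (faceAt x k))
    (hreach : ∃ hf : Site 2, ¬ E.IsInnerFace hf ∧
      (openGraph (dualConfig (E.bcBondConfig ω))).Reachable (faceAt x k) hf) :
    ∃ e ∈ medialExploration E ω, x ∈ e := by
  obtain ⟨m, hm, h⟩ := stub_touch_criterion_arcA Dm E hE hΩ ω x k hxA hin hreach
  exact ⟨_, cSrc_mem_medialExploration_of_cornerOrbit_eq hE ω hm h, Sym2.mem_mk_left _ _⟩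

/-- **Touch criterion at the dual-wired arc, interface form.** If the site `y`, joined to the
arc `A` by open edges, has an inner face `faceAt y k` whose target edge ends on the arc `B`, the
exploration path visits an edge at `y` and the `A`–`B`-type edge `cTgt (y, k)` lies on it as the
next medial vertex (here we record the visit at `y`). -/
theorem exists_mem_medialExploration_of_reachable_arcB (Dm : DobrushinDomain) {E : DiscreteDobrushin}
    (hE : E.IsZdAdmissible) (hΩ : E.Ω = Dm.carrier) (ω : BondConfig (Site 2)) {y : Site 2} {k : Fin 4}
    (hin : E.IsInnerFace (faceAt y k)) (hB : y + cornerUnit (k + 1) ∈ E.zdArcB)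
    (hreach : ∃ a ∈ E.zdArcA, (openGraph (E.bcBondConfig ω)).Reachable a y) :
    ∃ e ∈ medialExploration E ω, y ∈ e := by
  obtain ⟨m, hm, h⟩ := stub_touch_criterion_arcB Dm E hE hΩ ω y k hin hB hreach
  exact ⟨_, cSrc_mem_medialExploration_of_cornerOrbit_eq hE ω hm h, Sym2.mem_mk_left _ _⟩

end Summit.CriticalPhenomena.CardyFormulaZ2.Cruxes.LagHandOff.HittingTournament

end
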